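import Summits.NavierStokesRegularity.NavierStokesRegularity.Theses.AxisymmetricExtremality
import Summits.NavierStokesRegularity.NavierStokesRegularity.Theorems.AxisymmetricExtremalityMinimalDatumPFoldThresholdFinite
import Summits.NavierStokesRegularity.NavierStokesRegularity.Theorems.AxisymmetricExtremalityMinimalDatumPFoldNotAeZero
import Summits.NavierStokesRegularity.NavierStokesRegularity.Theorems.AxisymmetricExtremalityMinimalDatumPFoldRecentre
import Summits.NavierStokesRegularity.NavierStokesRegularity.Theorems.AxisymmetricExtremalityMinimalDatumPFoldAeToExact
import Summits.NavierStokesRegularity.NavierStokesRegularity.Theorems.AxisymmetricExtremalityMinimalDatumPFoldNearMinimalLimit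
import Summits.NavierStokesRegularity.NavierStokesRegularity.Theorems.AxisymmetricExtremalityMinimalDatumPFoldSymmetryDefectInLimit

/-!
# Route AxisymmetricExtremality — crux `MinimalDatumPFold` (stmt-NavierStokesRegularity-15452) reduced to symmetric gap closing

`MinimalDatumPFold` (Clay failure at viscosity `ν` ⇒ for unboundedly many `p ≥ 2` an exactly
`R_{2π/p}`-equivariant Rusin–Šverák minimal blow-up datum) follows from ONE statement, the INFIMUM
form of extremality of symmetry (line `symmetric-gap` of the crux, `Cruxes/MinimalDatumPFold/Lines/symmetric_gap.lean`,
registered stub `stub_symmGapClosing`): Clay failure at `ν` ⇒ for unboundedly many `p ≥ 2` and every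
`ε > 0` there is an a.e.-`R_{2π/p}`-equivariant blow-up datum of `Ḣ^{1/2}`-norm `< ρ_max^pure(ν) + ε`
(`ρ_p = ρ_max` as an infimum). That statement is strictly weaker in form than the Smith fixed point of
line `birth` (`minimalDatumPFold_of_smithFixedModSim`, `…OfSmith.lean`) and carries the whole open content.
Everything else is PROVED in the tree and composed here: the front end
`stub_thresholdFinite_of_clayFailure` (Clay failure ⇒ `ρ_max^pure(ν) < ⊤`), ATTAINMENT
`stub_nearMinimalLimit` (near-minimal blow-up sequences have, modulo `Sim` and along a subsequence,
an `L³`-limit in `M`: weak-limit blow-up + weak compactness + Radon–Riesz), `stub_minimalDatum_not_aeZero`,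
`stub_symmetryDefectInLimit` (the discrete symmetry survives modulated `L³`-limits up to a horizontal
shift of the axis), `stub_liftRecentre` (recentring), `stub_liftAeToExact` (exact equivariance).

## References
* W. Rusin, V. Šverák, J. Funct. Anal. 260 (2011) 879–891; arXiv:0911.0500, Cor. 4.3 and its proof, §1 p. 3.
* I. Gallagher, G. Koch, F. Planchon, Math. Ann. 355 (2013); arXiv:1012.0145, Thm. 9.
-/

set_option linter.dupNamespace false

namespace Summit.NavierStokesRegularity.NavierStokesRegularity.Theorems

/-- **The crux `MinimalDatumPFold` modulo symmetric gap closing.** If for every `ν > 0` at which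
Clay (A) fails and every `N` there is `p ≥ max(N, 2)` such that for every `ε > 0` some blow-up datum
(`L³`, represented in `Ḣ^{1/2}`, weakly divergence-free, no global Kato solution) of norm
`< ρ_max^pure(ν) + ε` is a.e. equivariant under the rotation `R_{2π/p}` about the `x₂`-axis, then
`AxisymmetricExtremality.MinimalDatumPFold` holds: the threshold is finite
(`stub_thresholdFinite_of_clayFailure`); with `ε = 1/(k+1)` the hypothesis gives a near-minimal
a.e.-symmetric blow-up sequence; `stub_nearMinimalLimit` extracts a modulated `L³`-limit
`(u, g) ∈ M`; `u` is not a.e. zero (`stub_minimalDatum_not_aeZero`); `stub_symmetryDefectInLimit`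
makes `u` equivariant up to a horizontal shift; `stub_liftRecentre` recentres the axis and
`stub_liftAeToExact` makes the equivariance exact.
[cite: RusinSverak2011, Cor. 4.3 and its proof (arXiv:0911.0500 p. 8), §1 p. 3] -/
theorem minimalDatumPFold_of_symmGapClosing :
    (∀ ν : ℝ, 0 < ν → (∃ v₀ : EuclideanSpace ℝ (Fin 3) → EuclideanSpace ℝ (Fin 3), ContDiff ℝ (⊤ : ℕ∞) v₀ ∧ Literature.Analysis.FluidPDE.NSWave0.IsDivFree v₀ ∧ Literature.Analysis.FluidPDE.HasRapidSpatialDecay v₀ ∧ ¬ ∃ (u : ℝ → EuclideanSpace ℝ (Fin 3) → EuclideanSpace ℝ (Fin 3)) (p : ℝ → EuclideanSpace ℝ (Fin 3) → ℝ), Literature.Analysis.FluidPDE.IsSmoothOnHalfSpace u ∧ Literature.Analysis.FluidPDE.IsSmoothOnHalfSpace p ∧ Literature.Analysis.FluidPDE.IsNavierStokesSolution ν 0 v₀ u p ∧ Literature.Analysis.FluidPDE.HasBoundedEnergy u) → ∀ N : ℕ, ∃ p : ℕ, N ≤ p ∧ 2 ≤ p ∧ ∀ ε : ENNReal, 0 <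 ε → ∃ (u₀ : EuclideanSpace ℝ (Fin 3) → EuclideanSpace ℝ (Fin 3)) (g : Literature.Analysis.FunctionSpaces.HomSobolev (EuclideanSpace ℝ (Fin 3)) (EuclideanSpace ℂ (Fin 3)) (1 / 2 : ℝ)), MeasureTheory.MemLp u₀ 3 (MeasureTheory.volume : MeasureTheory.Measure (EuclideanSpace ℝ (Fin 3))) ∧ g.Represents (Literature.Analysis.FunctionSpaces.EuclideanSpace.complexify ∘ u₀) ∧ Literature.Analysis.FluidPDE.IsWeaklyDivFree u₀ ∧ ¬ Literature.Analysis.FluidPDE.HasGlobalKatoSolution ν u₀ ∧ ‖g‖ₑ < Literature.Analysis.FluidPDE.rusinSverakRhoMaxPure ν + ε ∧ ∀ᵐ x ∂(MeasureTheory.volume : MeasureTheory.Measure (EuclideanSpace ℝ (Fin 3))), u₀ (WithLp.toLp 2 ![Real.cos (2 * Real.pi / p) * x 0 - Real.sin (2 * Real.pi / p) * x 1, Real.sin (2 * Real.pi / p) * x 0 + Real.cos (2 * Real.pi / p) * x 1, x 2]) = WithLp.toLp 2 ![Real.cos (2 * Real.pi / p) * u₀ x 0 - Real.sin (2 * Real.pi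 / p) * u₀ x 1, Real.sin (2 * Real.pi / p) * u₀ x 0 + Real.cos (2 * Real.pi / p) * u₀ x 1, u₀ x 2]) → Summit.NavierStokesRegularity.NavierStokesRegularity.Theses.AxisymmetricExtremality.MinimalDatumPFold := by
  intro hA ν hν hclay N
  have hfin : Literature.Analysis.FluidPDE.rusinSverakRhoMaxPure ν < ⊤ :=
    stub_thresholdFinite_of_clayFailure ν hν hclay
  obtain ⟨p, hNp, h2p, hfam⟩ := hA ν hν hclay N
  have hpos : ∀ k : ℕ, (0 : ENNReal) < ((k : ENNReal) + 1)⁻¹ := fun k =>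
    ENNReal.inv_pos.2 (by simp)
  choose U G hU using fun k : ℕ => hfam (((k : ENNReal) + 1)⁻¹) (hpos k)
  obtain ⟨lam, x₀, φ, u, g, hlam, _hφ, hmin, htend⟩ := stub_nearMinimalLimit ν hν hfin U G
    (fun k => ⟨(hU k).1, (hU k).2.1, (hU k).2.2.1, (hU k).2.2.2.1, (hU k).2.2.2.2.1⟩)
  have hne := stub_minimalDatum_not_aeZero ν u g hmin
  have hL3 : MeasureTheory.MemLp u 3 (MeasureTheory.volume : MeasureTheory.Measure (EuclideanSpace ℝ (Fin 3))) := by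
    obtain ⟨h3, -, -, -, -⟩ := hmin
    exact h3
  obtain ⟨x₁, hx₁, hfix⟩ := stub_symmetryDefectInLimit p (fun j => U (φ j)) lam x₀ u (fun j => (hU (φ j)).1)
    (fun j => (hU (φ j)).2.2.2.2.2) hlam hL3 hne htend
  obtain ⟨u₁, g₁, hmin₁, hfix₁⟩ := stub_liftRecentre ν p h2p u g hmin x₁ hx₁ hfix
  obtain ⟨u₂, g₂, hmin₂, hsym⟩ := stub_liftAeToExact ν p h2p u₁ g₁ hmin₁ hfix₁
  exact ⟨p, hNp, h2p, u₂, g₂, hmin₂, hsym⟩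

end Summit.NavierStokesRegularity.NavierStokesRegularity.Theorems
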